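import Summits.AtomisticToContinuum.HydrodynamicLimit.Theorems.MourreKoopmanChargesLinearToEntropyInBandVisCoreNToolkitC
import Summits.AtomisticToContinuum.HydrodynamicLimit.Theorems.RelayRaceLocalityNearConstantShortTimeHLEntropyPrice
import Summits.AtomisticToContinuum.HydrodynamicLimit.Theorems.JaynesSqueezeBlockGibbsToRelEntropyLedger
import Summits.AtomisticToContinuum.HydrodynamicLimit.Theorems.ImplosionDichotomyHydroLimitInBandWindowBalance
import HarnessLib

/-!
# Route `MourreKoopmanCharges`, crux `LinearToEntropyInBand` (stmt-AtomisticToContinuum-17740), skeleton v7: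
# first pieces of stub 4a-ii `stub_windowClauseOfOneBlockInBand` — part B (entropy pricing of the static block inputs)

Support file (`--supports stmt-AtomisticToContinuum-17740`; registered helper `stub_windowClausePricing`; worker of lead
prover-line-…-17740-c5-0, wave 3), companion of part A (`…WindowClausePieces`).  THE EXCHANGE RATES OF
`MesoscopicBlockLD` UNDER THE TRUE LAW (AUDIT-4a § 2 (d), § 3 item 5): from the exponential-moment bounds (ii), resp. (i),
of `MesoscopicBlockLD` under the reference local Gibbs law `ψ` at ONE `(N, s)` — taken as HYPOTHESES, the def is not
assumed — the Gibbs inequality along the flow for a nonnegative static functional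
(`NearConstantShortTimeHL.integral_comp_flow_le_klDiv_add_log_of_nonneg`) gives, along the flow started from the local
Gibbs law `P` (`f_s = (Φ_s)_* P`):
* `E_P[dense content ∘ Φ_s] ≤ lam⁻¹ (KL(f_s ‖ ψ) + ε (N+1))` for the `(1 + ‖v − wv(x)‖²)`-weighted dense content of
  (ii) — it prices the NUMBER and the mass / momentum / energy content of the slow-but-dense particles the visible
  functional `visCoreN` drops (`abs_sum_invisible_le` of part A), at the `O(1)` rate `lam₀`;
* `E_P[(N+1) ∫ (ρ̄ − ρ₀)² + ‖m̄ − ρ₀ wv‖² ∘ Φ_s] ≤ a⁻¹ KL(f_s ‖ ψ) + (N+1)(C/k³ + ε)` for the Gaussian-scale block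
  fluctuations of (i) — the density / momentum part of the QUADRATIC one-block remainder, Grönwall constant `a₀⁻¹`
  fixed before `ε`.
Integrability is part of the conclusions (second Gaussian moments along the flow,
`EntropyClockDock.integrable_sum_norm_sq_flow`; the visible block fields are bounded by the cone peak); the entropy is
finite by `JaynesSqueezeClosure.klDiv_lawAt_localGibbsLaw_ne_top`.  Nothing here restates the crux, a stub or the
Statement.  References: H.-T. Yau, Lett. Math. Phys. 22 (1991) § 2; C. Kipnis, C. Landim, *Scaling Limits of Interacting
Particle Systems* (1999) App. 1 § 8.
-/

noncomputable section

open MeasureTheory Filter Set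
open scoped ENNReal Topology InnerProductSpace BigOperators

namespace Summit.AtomisticToContinuum.HydrodynamicLimit.Theorems.LTEInBand

open Literature.MathematicalPhysics.KineticTheory Literature.Analysis.FluidPDE Literature.Analysis.FunctionSpaces

/-! ## Entropy pricing of the static block inputs under the true law (exchange rates of `MesoscopicBlockLD`) -/

section Pricing

variable {σ : ℝ} {N : ℕ} (Φ : HardSphereFlow (Torus.geometry (Fin 3)) (hsDiameter σ N) (N + 1))
  {a₀ θ₀ b ϑ ρ₀ : T3 → ℝ} {u₀ wv : T3 → V3}

/-- The `(1 + ‖v − wv(x)‖²)`-weighted dense content of a configuration (the exponent of `MesoscopicBlockLD` (ii) at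
threshold constant `c`, `c = 5/4` there) is a measurable function of the configuration. -/
theorem measurable_denseContent (hρ₀ : Measurable ρ₀) (hwv : Measurable wv) (c R : ℝ) :
    Measurable fun z : Config (N + 1) (Fin 3) T3 => ∑ i : Fin (N + 1),
      (if c * ρ₀ (z i).1 < ((N : ℝ) + 1)⁻¹ * ∑ j : Fin (N + 1), cone R N (z i).1 (z j).1
        then 1 + ‖(z i).2 - wv (z i).1‖ ^ 2 else 0) := by
  refine Finset.measurable_sum _ fun i _ => ?_
  have hx : Measurable fun z : Config (N + 1) (Fin 3) T3 => (z i).1 := (measurable_pi_apply i).fst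
  have hv : Measurable fun z : Config (N + 1) (Fin 3) T3 => (z i).2 := (measurable_pi_apply i).snd
  refine Measurable.ite (measurableSet_lt (measurable_const.mul (hρ₀.comp hx))
    (measurable_const.mul (Finset.measurable_sum _ fun j _ => measurable_cone_comp R N hx (measurable_pi_apply j).fst)))
    (measurable_const.add ((hv.sub (hwv.comp hx)).norm.pow_const 2)) measurable_const

/-- Domination of the weighted dense content by the kinetic energy: with `‖wv‖ ≤ U`,
`Σᵢ 𝟙{dense}(1 + ‖vᵢ − wv(xᵢ)‖²) ≤ (N+1)(1 + 2U²) + 2 Σᵢ ‖vᵢ‖²`. -/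
theorem denseContent_le_energy {U : ℝ} (hU : ∀ x, ‖wv x‖ ≤ U) (c R : ℝ) (z : Config (N + 1) (Fin 3) T3) :
    (∑ i : Fin (N + 1), (if c * ρ₀ (z i).1 < ((N : ℝ) + 1)⁻¹ * ∑ j : Fin (N + 1), cone R N (z i).1 (z j).1
        then 1 + ‖(z i).2 - wv (z i).1‖ ^ 2 else 0)) ≤ ((N : ℝ) + 1) * (1 + 2 * U ^ 2) + 2 * ∑ i, ‖(z i).2‖ ^ 2 := by
  have hU0 : 0 ≤ U := (norm_nonneg _).trans (hU 0)
  have hterm : ∀ i : Fin (N + 1), (if c * ρ₀ (z i).1 < ((N : ℝ) + 1)⁻¹ * ∑ j : Fin (N + 1), cone R N (z i).1 (z j).1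
      then 1 + ‖(z i).2 - wv (z i).1‖ ^ 2 else 0) ≤ (1 + 2 * U ^ 2) + 2 * ‖(z i).2‖ ^ 2 := by
    intro i
    have hwx : ‖wv (z i).1‖ ≤ U := hU _
    have h1 : ‖(z i).2 - wv (z i).1‖ ≤ ‖(z i).2‖ + U := by
      have := norm_sub_le (z i).2 (wv (z i).1)
      linarith
    have h2 : ‖(z i).2 - wv (z i).1‖ ^ 2 ≤ (‖(z i).2‖ + U) ^ 2 := pow_le_pow_left₀ (norm_nonneg _) h1 2
    have h3 : (‖(z i).2‖ + U) ^ 2 ≤ 2 * ‖(z i).2‖ ^ 2 + 2 * U ^ 2 := by nlinarith [sq_nonneg (‖(z i).2‖ - U)]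
    split_ifs
    · linarith
    · positivity
  calc _ ≤ ∑ i : Fin (N + 1), ((1 + 2 * U ^ 2) + 2 * ‖(z i).2‖ ^ 2) := Finset.sum_le_sum fun i _ => hterm i
    _ = ((N : ℝ) + 1) * (1 + 2 * U ^ 2) + 2 * ∑ i, ‖(z i).2‖ ^ 2 := by
        rw [Finset.sum_add_distrib, Finset.sum_const, Finset.card_univ, Fintype.card_fin, nsmul_eq_mul, Finset.mul_sum]
        push_cast; ring

/-- The weighted dense content is nonnegative. -/
theorem denseContent_nonneg (c R : ℝ) (z : Config (N + 1) (Fin 3) T3) :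
    0 ≤ ∑ i : Fin (N + 1), (if c * ρ₀ (z i).1 < ((N : ℝ) + 1)⁻¹ * ∑ j : Fin (N + 1), cone R N (z i).1 (z j).1
        then 1 + ‖(z i).2 - wv (z i).1‖ ^ 2 else 0) :=
  Finset.sum_nonneg fun i _ => by split_ifs <;> positivity

/-- **Exchange rate of `MesoscopicBlockLD` (ii): the dense content under the TRUE law.** If the reference local Gibbs law
`ψ = localGibbsLaw σ b wv ϑ N Φ` carries the exponential moment of (ii) at rate `lam > 0` and accuracy `ε`,
`∫ exp(lam Σᵢ 𝟙{c ρ₀(xᵢ) < cone density}(1 + ‖vᵢ − wv(xᵢ)‖²)) dψ ≤ e^{ε (N+1)}`, then along the flow started from the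
local Gibbs law `P = localGibbsLaw σ a₀ u₀ θ₀ N Φ` the dense content at time `s` is integrable and
`E_P[dense content ∘ Φ_s] ≤ lam⁻¹ (KL(f_s ‖ ψ) + ε (N+1))`, `f_s = (Φ_s)_* P` — the Gibbs inequality for a nonnegative
static functional (`NearConstantShortTimeHL.integral_comp_flow_le_klDiv_add_log_of_nonneg`), the entropy being finite
(`JaynesSqueezeClosure.klDiv_lawAt_localGibbsLaw_ne_top`) and the functional dominated by `(N+1)(1 + 2U²) + 2 Σᵢ ‖vᵢ‖²`
(second Gaussian moments are conserved in mean along the flow, `EntropyClockDock.integrable_sum_norm_sq_flow`). -/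
theorem integral_denseContent_flow_le (hσ2 : σ ≤ 1 / 2) (ha : Continuous a₀) (hθ : Continuous θ₀) (hu : Continuous u₀)
    (ha0 : ∀ x, 0 < a₀ x) (hθ0 : ∀ x, 0 < θ₀ x) (hb : Continuous b) (hϑ : Continuous ϑ) (hwv : Continuous wv)
    (hb0 : ∀ x, 0 < b x) (hϑ0 : ∀ x, 0 < ϑ x) (hρ₀ : Measurable ρ₀) (c R : ℝ) {lam ε : ℝ} (hlam : 0 < lam) (s : ℝ)
    (hB : ∫⁻ z, ENNReal.ofReal (Real.exp (lam * ∑ i : Fin (N + 1),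
        (if c * ρ₀ (z i).1 < ((N : ℝ) + 1)⁻¹ * ∑ j : Fin (N + 1), cone R N (z i).1 (z j).1
          then 1 + ‖(z i).2 - wv (z i).1‖ ^ 2 else 0))) ∂(localGibbsLaw σ b wv ϑ N Φ) ≤
      ENNReal.ofReal (Real.exp (ε * ((N : ℝ) + 1)))) :
    Integrable (fun z => ∑ i : Fin (N + 1),
        (if c * ρ₀ (Φ.flow s z i).1 < ((N : ℝ) + 1)⁻¹ * ∑ j : Fin (N + 1), cone R N (Φ.flow s z i).1 (Φ.flow s z j).1
          then 1 + ‖(Φ.flow s z i).2 - wv (Φ.flow s z i).1‖ ^ 2 else 0)) (localGibbsLaw σ a₀ u₀ θ₀ N Φ) ∧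
      ∫ z, ∑ i : Fin (N + 1),
        (if c * ρ₀ (Φ.flow s z i).1 < ((N : ℝ) + 1)⁻¹ * ∑ j : Fin (N + 1), cone R N (Φ.flow s z i).1 (Φ.flow s z j).1
          then 1 + ‖(Φ.flow s z i).2 - wv (Φ.flow s z i).1‖ ^ 2 else 0) ∂(localGibbsLaw σ a₀ u₀ θ₀ N Φ) ≤
        lam⁻¹ * ((InformationTheory.klDiv (Φ.lawAt (localGibbsLaw σ a₀ u₀ θ₀ N Φ) s) (localGibbsLaw σ b wv ϑ N Φ)).toReal +
          ε * ((N : ℝ) + 1)) := by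
  haveI : IsProbabilityMeasure (localGibbsLaw σ a₀ u₀ θ₀ N Φ) := isProbabilityMeasure_localGibbsLaw ha hθ hu ha0 hθ0 hσ2 N Φ
  haveI : IsProbabilityMeasure (localGibbsLaw σ b wv ϑ N Φ) := isProbabilityMeasure_localGibbsLaw hb hϑ hwv hb0 hϑ0 hσ2 N Φ
  have hGm := measurable_denseContent (N := N) hρ₀ hwv.measurable c R
  have hG0 := fun z => denseContent_nonneg (N := N) (ρ₀ := ρ₀) (wv := wv) c R z
  obtain ⟨U, hU⟩ : ∃ U, ∀ x, ‖wv x‖ ≤ U := by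
    obtain ⟨U, hU⟩ := isCompact_univ.exists_bound_of_continuousOn hwv.continuousOn
    exact ⟨U, fun x => hU x (Set.mem_univ x)⟩
  have hint : Integrable (fun z => ∑ i : Fin (N + 1),
      (if c * ρ₀ (Φ.flow s z i).1 < ((N : ℝ) + 1)⁻¹ * ∑ j : Fin (N + 1), cone R N (Φ.flow s z i).1 (Φ.flow s z j).1
        then 1 + ‖(Φ.flow s z i).2 - wv (Φ.flow s z i).1‖ ^ 2 else 0)) (localGibbsLaw σ a₀ u₀ θ₀ N Φ) := by
    have hE := EntropyClockDock.integrable_sum_norm_sq_flow ha hθ hu (fun x => (ha0 x).le) hθ0 σ N Φ s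
    refine ((integrable_const (((N : ℝ) + 1) * (1 + 2 * U ^ 2))).add (hE.const_mul 2)).mono'
      (hGm.comp (Φ.measurable_flow s)).aestronglyMeasurable (ae_of_all _ fun z => ?_)
    rw [Real.norm_eq_abs, abs_of_nonneg (hG0 _)]
    exact denseContent_le_energy hU c R _
  have hfin := JaynesSqueezeClosure.klDiv_lawAt_localGibbsLaw_ne_top hσ2 ha hθ hu ha0 hθ0 hb hϑ hwv hb0 hϑ0 N Φ s
  exact ⟨hint, NearConstantShortTimeHL.integral_comp_flow_le_klDiv_add_log_of_nonneg Φ _ _ s hfin hGm hG0 hint hlam hB⟩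

/-- The cone kernel is bounded by its peak value `3 / (π r³)`, `r = k (N+1)^{-1/3} > 0`. -/
theorem cone_le_peak {k : ℝ} (hk : 0 < k) (x y : T3) :
    cone k N x y ≤ 3 / (Real.pi * (k * ((N : ℝ) + 1) ^ (-(1 / 3 : ℝ))) ^ 3) := by
  have hr : 0 < k * ((N : ℝ) + 1) ^ (-(1 / 3 : ℝ)) := mul_pos hk (Real.rpow_pos_of_pos (by positivity) _)
  unfold cone
  refine mul_le_of_le_one_right (by positivity) (max_le zero_le_one ?_)
  have hd : 0 ≤ Torus.euclidDist x y := by rw [Torus.euclidDist_eq]; exact norm_nonneg _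
  have : 0 ≤ Torus.euclidDist x y / (k * ((N : ℝ) + 1) ^ (-(1 / 3 : ℝ))) := div_nonneg hd hr.le
  linarith

/-- The visible block density is bounded by the peak value of the cone kernel (at most `N + 1` visible particles,
each contributing at most the peak, normalised by `(N+1)⁻¹`). -/
theorem visDensityN_le_peak {k : ℝ} (hk : 0 < k) (R K : ℝ) (y : Config (N + 1) (Fin 3) T3) (x : T3) :
    visDensityN ρ₀ wv R K k N y x ≤ 3 / (Real.pi * (k * ((N : ℝ) + 1) ^ (-(1 / 3 : ℝ))) ^ 3) := by
  set D : ℝ := 3 / (Real.pi * (k * ((N : ℝ) + 1) ^ (-(1 / 3 : ℝ))) ^ 3) with hD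
  have hr : 0 < k * ((N : ℝ) + 1) ^ (-(1 / 3 : ℝ)) := mul_pos hk (Real.rpow_pos_of_pos (by positivity) _)
  have hD0 : 0 ≤ D := by positivity
  unfold visDensityN
  have hle : ∑ i, (if VisibleN ρ₀ wv R K N y i then cone k N x (y i).1 else 0) ≤ ∑ _i : Fin (N + 1), D :=
    Finset.sum_le_sum fun i _ => by
      split_ifs
      exacts [cone_le_peak hk _ _, hD0]
  rw [Finset.sum_const, Finset.card_univ, Fintype.card_fin, nsmul_eq_mul] at hle
  calc ((N : ℝ) + 1)⁻¹ * ∑ i, (if VisibleN ρ₀ wv R K N y i then cone k N x (y i).1 else 0)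
      ≤ ((N : ℝ) + 1)⁻¹ * (((N + 1 : ℕ) : ℝ) * D) := mul_le_mul_of_nonneg_left hle (by positivity)
    _ = D := by push_cast; field_simp

/-- The integrand of `MesoscopicBlockLD` (i) — squared block fluctuations of the visible density and momentum around
the profile — is jointly measurable in (configuration, point) for measurable reference fields. -/
theorem measurable_blockFluctuationDensity (hρ₀ : Measurable ρ₀) (hwv : Measurable wv) (R K k : ℝ) :
    Measurable fun q : Config (N + 1) (Fin 3) T3 × T3 =>
      (visDensityN ρ₀ wv R K k N q.1 q.2 - ρ₀ q.2) ^ 2 + ‖visMomentumN ρ₀ wv R K k N q.1 q.2 - ρ₀ q.2 • wv q.2‖ ^ 2 := by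
  obtain ⟨hρ, hm, -⟩ := measurable_visBlockFields hρ₀ hwv R K k N
  exact ((hρ.sub (hρ₀.comp measurable_snd)).pow_const 2).add
    ((hm.sub ((hρ₀.comp measurable_snd).smul (hwv.comp measurable_snd))).norm.pow_const 2)

/-- **Exchange rate of `MesoscopicBlockLD` (i): the quadratic one-block remainder under the TRUE law.** If the reference
local Gibbs law `ψ = localGibbsLaw σ b wv ϑ N Φ` carries the Gaussian-scale exponential moment of (i) at rate `a > 0`,
`∫ exp(a (N+1) ∫ (ρ̄ − ρ₀)² + ‖m̄ − ρ₀ wv‖² dx) dψ ≤ exp(a (N+1)(C/k³ + ε))`, then along the flow started from the local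
Gibbs law `P` the block fluctuation functional at time `s` is integrable (it is bounded: the visible block fields are
bounded by the cone peak, `visDensityN_le_peak`, `norm_visMomentumN_le`) and
`E_P[(N+1) ∫ (ρ̄ − ρ₀)² + ‖m̄ − ρ₀ wv‖² ∘ Φ_s] ≤ a⁻¹ KL(f_s ‖ ψ) + (N+1)(C/k³ + ε)` — the `O(1)` exchange rate `a⁻¹` is
the Grönwall constant `K_q` of the quadratic remainder in the window clause (fixed before `ε`). -/
theorem integral_blockFluctuation_flow_le (hσ2 : σ ≤ 1 / 2) (ha : Continuous a₀) (hθ : Continuous θ₀)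
    (hu : Continuous u₀) (ha0 : ∀ x, 0 < a₀ x) (hθ0 : ∀ x, 0 < θ₀ x) (hb : Continuous b) (hϑ : Continuous ϑ)
    (hwv : Continuous wv) (hb0 : ∀ x, 0 < b x) (hϑ0 : ∀ x, 0 < ϑ x) (hρ₀ : Continuous ρ₀) (R K : ℝ) {k a C ε : ℝ}
    (hk : 0 < k) (hapos : 0 < a) (s : ℝ)
    (hB : ∫⁻ z, ENNReal.ofReal (Real.exp (a * (((N : ℝ) + 1) *
        ∫ x, ((visDensityN ρ₀ wv R K k N z x - ρ₀ x) ^ 2 + ‖visMomentumN ρ₀ wv R K k N z x - ρ₀ x • wv x‖ ^ 2))))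
        ∂(localGibbsLaw σ b wv ϑ N Φ) ≤ ENNReal.ofReal (Real.exp (a * (((N : ℝ) + 1) * (C / k ^ 3 + ε))))) :
    Integrable (fun z => ((N : ℝ) + 1) *
        ∫ x, ((visDensityN ρ₀ wv R K k N (Φ.flow s z) x - ρ₀ x) ^ 2 +
          ‖visMomentumN ρ₀ wv R K k N (Φ.flow s z) x - ρ₀ x • wv x‖ ^ 2)) (localGibbsLaw σ a₀ u₀ θ₀ N Φ) ∧
      ∫ z, ((N : ℝ) + 1) *
          (∫ x, ((visDensityN ρ₀ wv R K k N (Φ.flow s z) x - ρ₀ x) ^ 2 +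
            ‖visMomentumN ρ₀ wv R K k N (Φ.flow s z) x - ρ₀ x • wv x‖ ^ 2)) ∂(localGibbsLaw σ a₀ u₀ θ₀ N Φ) ≤
        a⁻¹ * (InformationTheory.klDiv (Φ.lawAt (localGibbsLaw σ a₀ u₀ θ₀ N Φ) s) (localGibbsLaw σ b wv ϑ N Φ)).toReal +
          ((N : ℝ) + 1) * (C / k ^ 3 + ε) := by
  haveI : IsProbabilityMeasure (localGibbsLaw σ a₀ u₀ θ₀ N Φ) := isProbabilityMeasure_localGibbsLaw ha hθ hu ha0 hθ0 hσ2 N Φ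
  haveI : IsProbabilityMeasure (localGibbsLaw σ b wv ϑ N Φ) := isProbabilityMeasure_localGibbsLaw hb hϑ hwv hb0 hϑ0 hσ2 N Φ
  have hF := measurable_blockFluctuationDensity (N := N) hρ₀.measurable hwv.measurable R K k
  have hGm : Measurable fun z : Config (N + 1) (Fin 3) T3 => ((N : ℝ) + 1) *
      ∫ x, ((visDensityN ρ₀ wv R K k N z x - ρ₀ x) ^ 2 + ‖visMomentumN ρ₀ wv R K k N z x - ρ₀ x • wv x‖ ^ 2) :=
    measurable_const.mul (hF.stronglyMeasurable.integral_prod_right' (ν := volume)).measurable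
  have hG0 : ∀ z : Config (N + 1) (Fin 3) T3, 0 ≤ ((N : ℝ) + 1) *
      ∫ x, ((visDensityN ρ₀ wv R K k N z x - ρ₀ x) ^ 2 + ‖visMomentumN ρ₀ wv R K k N z x - ρ₀ x • wv x‖ ^ 2) :=
    fun z => mul_nonneg (by positivity) (integral_nonneg fun x => by positivity)
  -- boundedness: the visible block fields are bounded by the cone peak
  obtain ⟨U, hU⟩ : ∃ U, ∀ x, ‖wv x‖ ≤ U := by
    obtain ⟨U, hU⟩ := isCompact_univ.exists_bound_of_continuousOn hwv.continuousOn
    exact ⟨U, fun x => hU x (Set.mem_univ x)⟩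
  obtain ⟨P₀, hP₀⟩ : ∃ P₀, ∀ x, ‖ρ₀ x‖ ≤ P₀ := by
    obtain ⟨P₀, hP₀⟩ := isCompact_univ.exists_bound_of_continuousOn hρ₀.continuousOn
    exact ⟨P₀, fun x => hP₀ x (Set.mem_univ x)⟩
  set D : ℝ := 3 / (Real.pi * (k * ((N : ℝ) + 1) ^ (-(1 / 3 : ℝ))) ^ 3) with hD
  set B₀ : ℝ := (D + P₀) ^ 2 + (|K + U| * D + P₀ * U) ^ 2 with hB₀
  have hbound : ∀ (z : Config (N + 1) (Fin 3) T3) (x : T3),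
      ‖(visDensityN ρ₀ wv R K k N z x - ρ₀ x) ^ 2 + ‖visMomentumN ρ₀ wv R K k N z x - ρ₀ x • wv x‖ ^ 2‖ ≤ B₀ := by
    intro z x
    have hρle : visDensityN ρ₀ wv R K k N z x ≤ D := visDensityN_le_peak hk R K z x
    have hρge : 0 ≤ visDensityN ρ₀ wv R K k N z x := visDensityN_nonneg ρ₀ wv R K N hk.le z x
    have hρ₀x : |ρ₀ x| ≤ P₀ := by simpa only [Real.norm_eq_abs] using hP₀ x
    have h1 : |visDensityN ρ₀ wv R K k N z x - ρ₀ x| ≤ D + P₀ :=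
      (abs_sub _ _).trans (add_le_add (by rw [abs_of_nonneg hρge]; exact hρle) hρ₀x)
    have hm : ‖visMomentumN ρ₀ wv R K k N z x‖ ≤ |K + U| * D :=
      (norm_visMomentumN_le ρ₀ R N hU hk.le z x).trans
        ((mul_le_mul_of_nonneg_right (le_abs_self _) hρge).trans (mul_le_mul_of_nonneg_left hρle (abs_nonneg _)))
    have h2 : ‖visMomentumN ρ₀ wv R K k N z x - ρ₀ x • wv x‖ ≤ |K + U| * D + P₀ * U := by
      refine (norm_sub_le _ _).trans (add_le_add hm ?_)
      rw [norm_smul]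
      exact mul_le_mul (hP₀ x) (hU x) (norm_nonneg _) ((norm_nonneg _).trans (hP₀ x))
    rw [Real.norm_eq_abs, abs_of_nonneg (by positivity)]
    have h1' := pow_le_pow_left₀ (abs_nonneg _) h1 2
    have h2' := pow_le_pow_left₀ (norm_nonneg _) h2 2
    rw [sq_abs] at h1'
    exact add_le_add h1' h2'
  have hGb : ∀ z : Config (N + 1) (Fin 3) T3, ((N : ℝ) + 1) *
      ∫ x, ((visDensityN ρ₀ wv R K k N z x - ρ₀ x) ^ 2 + ‖visMomentumN ρ₀ wv R K k N z x - ρ₀ x • wv x‖ ^ 2) ≤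
      ((N : ℝ) + 1) * B₀ := by
    intro z
    refine mul_le_mul_of_nonneg_left ?_ (by positivity)
    have h := norm_integral_le_of_norm_le_const (μ := (volume : Measure T3)) (ae_of_all _ fun x => hbound z x)
    rw [Real.norm_eq_abs] at h
    simpa using (le_abs_self _).trans h
  have hint : Integrable (fun z => ((N : ℝ) + 1) *
      ∫ x, ((visDensityN ρ₀ wv R K k N (Φ.flow s z) x - ρ₀ x) ^ 2 +
        ‖visMomentumN ρ₀ wv R K k N (Φ.flow s z) x - ρ₀ x • wv x‖ ^ 2)) (localGibbsLaw σ a₀ u₀ θ₀ N Φ) := by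
    refine (integrable_const (((N : ℝ) + 1) * B₀)).mono' (hGm.comp (Φ.measurable_flow s)).aestronglyMeasurable
      (ae_of_all _ fun z => ?_)
    rw [Real.norm_eq_abs, abs_of_nonneg (hG0 _)]
    exact hGb _
  have hfin := JaynesSqueezeClosure.klDiv_lawAt_localGibbsLaw_ne_top hσ2 ha hθ hu ha0 hθ0 hb hϑ hwv hb0 hϑ0 N Φ s
  have hmain := NearConstantShortTimeHL.integral_comp_flow_le_klDiv_add_log_of_nonneg Φ _ _ s hfin hGm hG0 hint hapos hB
  refine ⟨hint, hmain.trans_eq ?_⟩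
  rw [mul_add, inv_mul_cancel_left₀ hapos.ne']

end Pricing

/-! ## The registered helper stub -/

/-- **Registered helper stub `stub_windowClausePricing` of skeleton v7 (crux stmt-17740, serving stub 4a-ii
`stub_windowClauseOfOneBlockInBand`)**: sorry-free conjunction of the two bounds of `integral_denseContent_flow_le` and
`integral_blockFluctuation_flow_le` (the integrability halves stay in the lemmas). -/
theorem stub_windowClausePricing : (∀ (σ : ℝ) (N : ℕ) (Φ : Literature.Analysis.FluidPDE.HardSphereFlow (Literature.Analysis.FluidPDE.Torus.geometry (Fin 3)) (Literature.MathematicalPhysics.KineticTheory.hsDiameter σ N) (N + 1)) (a₀ θ₀ b ϑ ρ₀ : Literature.MathematicalPhysics.KineticTheory.T3 → ℝ) (u₀ wv : Literature.MathematicalPhysics.KineticTheory.T3 → Literature.MathematicalPhysics.KineticTheory.V3), σ ≤ 1 / 2 → Continuous a₀ → Continuous θ₀ → Continuous u₀ → (∀ x, 0 < a₀ x) → (∀ x, 0 < θ₀ x) → Continuous b → Continuous ϑ → Continuous wv → (∀ x, 0 < b x) → (∀ x, 0 < ϑ x) → Measurable ρ₀ → ∀ (c R lam ε s : ℝ), 0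 < lam → MeasureTheory.lintegral (Literature.MathematicalPhysics.KineticTheory.localGibbsLaw σ b wv ϑ N Φ) (fun z => ENNReal.ofReal (Real.exp (lam * ∑ i : Fin (N + 1), (if c * ρ₀ (z i).1 < ((N : ℝ) + 1)⁻¹ * ∑ j : Fin (N + 1), Summit.AtomisticToContinuum.HydrodynamicLimit.Theorems.LTEInBand.cone R N (z i).1 (z j).1 then 1 + ‖(z i).2 - wv (z i).1‖ ^ 2 else 0)))) ≤ ENNReal.ofReal (Real.exp (ε * ((N : ℝ) + 1))) → MeasureTheory.integral (Literature.MathematicalPhysics.KineticTheory.localGibbsLaw σ a₀ u₀ θ₀ N Φ) (fun z => ∑ i : Fin (N + 1), (if c * ρ₀ (Φ.flow s z i).1 < ((N : ℝ) + 1)⁻¹ * ∑ j : Fin (N + 1), Summit.AtomisticToContinuum.HydrodynamicLimit.Theorems.LTEInBand.cone R N (Φ.flow s z i).1 (Φ.flow s z j).1 then 1 + ‖(Φ.flow s z i).2 - wv (Φ.flow s z i).1‖ ^ 2 else 0)) ≤ lam⁻¹ * ((InformationTheory.klDiv (Φ.lawAt (Literature.MathematicalPhysics.KineticTheory.localGibbsLaw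 σ a₀ u₀ θ₀ N Φ) s) (Literature.MathematicalPhysics.KineticTheory.localGibbsLaw σ b wv ϑ N Φ)).toReal + ε * ((N : ℝ) + 1))) ∧ (∀ (σ : ℝ) (N : ℕ) (Φ : Literature.Analysis.FluidPDE.HardSphereFlow (Literature.Analysis.FluidPDE.Torus.geometry (Fin 3)) (Literature.MathematicalPhysics.KineticTheory.hsDiameter σ N) (N + 1)) (a₀ θ₀ b ϑ ρ₀ : Literature.MathematicalPhysics.KineticTheory.T3 → ℝ) (u₀ wv : Literature.MathematicalPhysics.KineticTheory.T3 → Literature.MathematicalPhysics.KineticTheory.V3), σ ≤ 1 / 2 → Continuous a₀ → Continuous θ₀ → Continuous u₀ → (∀ x, 0 < a₀ x) → (∀ x, 0 < θ₀ x) → Continuous b → Continuous ϑ → Continuous wv → (∀ x, 0 < b x) → (∀ x, 0 < ϑ x) → Continuous ρ₀ → ∀ (R K k a C ε s : ℝ), 0 < k → 0 < a → MeasureTheory.lintegral (Literature.MathematicalPhysics.KineticTheory.localGibbsLaw σ b wv ϑ N Φ) (fun z => ENNReal.ofReal (Real.exp (a * (((N : ℝ) + 1) * MeasureTheory.integral MeasureTheory.volume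 (fun x => ((Summit.AtomisticToContinuum.HydrodynamicLimit.Theorems.LTEInBand.visDensityN ρ₀ wv R K k N z x - ρ₀ x) ^ 2 + ‖Summit.AtomisticToContinuum.HydrodynamicLimit.Theorems.LTEInBand.visMomentumN ρ₀ wv R K k N z x - ρ₀ x • wv x‖ ^ 2)))))) ≤ ENNReal.ofReal (Real.exp (a * (((N : ℝ) + 1) * (C / k ^ 3 + ε)))) → MeasureTheory.integral (Literature.MathematicalPhysics.KineticTheory.localGibbsLaw σ a₀ u₀ θ₀ N Φ) (fun z => ((N : ℝ) + 1) * MeasureTheory.integral MeasureTheory.volume (fun x => ((Summit.AtomisticToContinuum.HydrodynamicLimit.Theorems.LTEInBand.visDensityN ρ₀ wv R K k N (Φ.flow s z) x - ρ₀ x) ^ 2 + ‖Summit.AtomisticToContinuum.HydrodynamicLimit.Theorems.LTEInBand.visMomentumN ρ₀ wv R K k N (Φ.flow s z) x - ρ₀ x • wv x‖ ^ 2))) ≤ a⁻¹ * (InformationTheory.klDiv (Φ.lawAt (Literature.MathematicalPhysics.KineticTheory.localGibbsLaw σ a₀ u₀ θ₀ N Φ) s) (Literature.MathematicalPhysics.KineticTheory.localGibbsLaw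 σ b wv ϑ N Φ)).toReal + ((N : ℝ) + 1) * (C / k ^ 3 + ε)) :=
  ⟨fun _ _ Φ _ _ _ _ _ _ _ hσ2 ha hθ hu ha0 hθ0 hb hϑ hwv hb0 hϑ0 hρ₀ c R _ _ s hlam hB =>
      (integral_denseContent_flow_le Φ hσ2 ha hθ hu ha0 hθ0 hb hϑ hwv hb0 hϑ0 hρ₀ c R hlam s hB).2,
    fun _ _ Φ _ _ _ _ _ _ _ hσ2 ha hθ hu ha0 hθ0 hb hϑ hwv hb0 hϑ0 hρ₀ R K _ _ _ _ s hk ha' hB =>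
      (integral_blockFluctuation_flow_le Φ hσ2 ha hθ hu ha0 hθ0 hb hϑ hwv hb0 hϑ0 hρ₀ R K hk ha' s hB).2⟩

end Summit.AtomisticToContinuum.HydrodynamicLimit.Theorems.LTEInBand

end
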